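import Literature.NumberTheory.LFunctions.WeilTwoPrimeDeflL2Base
import Literature.NumberTheory.LFunctions.WeilBlockRowsPZ
import HarnessLib

/-!
# Deflated two-prime certificate L2: the factored even inverse agrees with `D`, rows 40–47

`WeilCert.checkDnRow` (even block) for certificate L2, by `decide +kernel`. Pure proof file.
-/

noncomputable section

namespace Literature.NumberTheory.LFunctions

set_option maxHeartbeats 0 in
/-- Row 40 of `DnE/LsE` is row 40 of the even `D` (certificate L2). [folklore] -/
theorem checkDnRow0_40_weilCertDeflL2 : weilCertDeflL2Base.checkDnRow weilCertDeflL2DnE weilCertDeflL2LsE 0 40 = true := by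
  decide +kernel

set_option maxHeartbeats 0 in
/-- Row 41 of `DnE/LsE` is row 41 of the even `D` (certificate L2). [folklore] -/
theorem checkDnRow0_41_weilCertDeflL2 : weilCertDeflL2Base.checkDnRow weilCertDeflL2DnE weilCertDeflL2LsE 0 41 = true := by
  decide +kernel

set_option maxHeartbeats 0 in
/-- Row 42 of `DnE/LsE` is row 42 of the even `D` (certificate L2). [folklore] -/
theorem checkDnRow0_42_weilCertDeflL2 : weilCertDeflL2Base.checkDnRow weilCertDeflL2DnE weilCertDeflL2LsE 0 42 = true := by
  decide +kernel

set_option maxHeartbeats 0 in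
/-- Row 43 of `DnE/LsE` is row 43 of the even `D` (certificate L2). [folklore] -/
theorem checkDnRow0_43_weilCertDeflL2 : weilCertDeflL2Base.checkDnRow weilCertDeflL2DnE weilCertDeflL2LsE 0 43 = true := by
  decide +kernel

set_option maxHeartbeats 0 in
/-- Row 44 of `DnE/LsE` is row 44 of the even `D` (certificate L2). [folklore] -/
theorem checkDnRow0_44_weilCertDeflL2 : weilCertDeflL2Base.checkDnRow weilCertDeflL2DnE weilCertDeflL2LsE 0 44 = true := by
  decide +kernel

set_option maxHeartbeats 0 in
/-- Row 45 of `DnE/LsE` is row 45 of the even `D` (certificate L2). [folklore] -/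
theorem checkDnRow0_45_weilCertDeflL2 : weilCertDeflL2Base.checkDnRow weilCertDeflL2DnE weilCertDeflL2LsE 0 45 = true := by
  decide +kernel

set_option maxHeartbeats 0 in
/-- Row 46 of `DnE/LsE` is row 46 of the even `D` (certificate L2). [folklore] -/
theorem checkDnRow0_46_weilCertDeflL2 : weilCertDeflL2Base.checkDnRow weilCertDeflL2DnE weilCertDeflL2LsE 0 46 = true := by
  decide +kernel

set_option maxHeartbeats 0 in
/-- Row 47 of `DnE/LsE` is row 47 of the even `D` (certificate L2). [folklore] -/
theorem checkDnRow0_47_weilCertDeflL2 : weilCertDeflL2Base.checkDnRow weilCertDeflL2DnE weilCertDeflL2LsE 0 47 = true := by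
  decide +kernel


end Literature.NumberTheory.LFunctions
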